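import Literature.NumberTheory.NumberFields.QuadraticExtensionOddClassNumberNonNormUnit
import Literature.NumberTheory.NumberFields.AmbiguousClassNumberInequality
import Literature.NumberTheory.NumberFields.HasseUnitIndexOddNarrowClassNumber
import Literature.NumberTheory.NumberFields.QuarticCMFieldOddRelativeClassNumberRamifiedPrime
import HarnessLib

/-!
# Narrow class number parity goes UP a totally real quadratic extension with at least two ramified primes:
# `h⁺(K)` odd, `L/K` quadratic, `L` totally real, `4 ∣ ∏_𝔭 e_𝔭(L/K)` ⟹ `h⁺(L)` even (narrow genus theory; proved, no definition, no named fact)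

Topic `NumberTheory/NumberFields`; namespace `Literature.NumberTheory.NumberFields.AmbiguousClass` (that of
`AmbiguousClassNumberFormula.lean`). THEOREM-ONLY file (no definition, no named fact, no instance, no `sorry`), written by the prover seat
`bsd-2adic-k4-w2` GEN 12 (cell `bsd-2adic`; `--supports` stmt-BirchSwinnertonDyer-22617: it decides NEGATIVELY the layer-`0/1` rung of the
narrow rank certificate — `rank₂ Cl⁺(K(√2)) = rank₂ Cl⁺(K)` — on every totally real cubic point field `K = ℚ(P)` of K4's additive census
with `h⁺(K) = 1` and two primes above `2`: there `rank₂ Cl⁺(K) = 0 < 1 ≤ rank₂ Cl⁺(K(√2))`, so the census instance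
`conjA_two_<L>_of_narrowRankEq₀₁` displays an unsatisfiable hypothesis and the rung `n = 1` is the first live one).

THE STATEMENT is the parity shadow of the NARROW ambiguous class number formula `#Am⁺(L/K) = h⁺(K) · 2^{t−1} / [E_K⁺ : E_K⁺ ∩ N_{L/K} Lˣ]`
(`L/K` quadratic, both totally real, `t` = number of ramified finite primes; Gras IV.4): when `h⁺(K)` is odd the totally
positive units of `K` are squares, hence norms, and `#Am⁺ = h⁺(K) · 2^{t−1}` is even as soon as `t ≥ 2`.  We do NOT formalise the narrow
formula; we prove its consequence from the tree's ORDINARY Chevalley formula (`ambiguousClassNumberFormula`, Lang Ch. 13 §4 Lemma 4.1):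

  `#Cl(L)^G · 2 · [E_K : E_K ∩ N_{L/K} Lˣ] = h(K) · ∏_𝔭 e_𝔭 · ∏_{v∣∞} e_v`,  `∏_{v∣∞} e_v = 1` (`L` totally real).

Suppose `h⁺(L)` were odd.  Then (Fröhlich–Taylor V (1.12): `h⁺ · #sign(U) = h · 2^{r₁}`) the units of `L` take EVERY signature (§1), and
every unit `u` of `K` is a norm from `Lˣ` (§3): choose a unit `w` of `L` whose sign at ONE real place above each real place `ρ` of `K` is the
sign of `ρ(u)` and `+` at the other (§2: the two places above `ρ` are `ψ_ρ` and `ψ_ρ ∘ σ`, distinct); then `ρ(N_{L/K} w) = ψ_ρ(w) · ψ_ρ(σ w)`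
has the sign of `ρ(u)`, so `u / N(w)` is a totally positive unit of `K`, hence the SQUARE of a unit (`h⁺(K)` odd: tree
`card_totPosUnitsModSq_eq_one_of_odd_narrowClassNumber`, `exists_units_eq_sq_of_card_totPosUnitsModSq_eq_one`), hence a norm; so
`[E_K : E_K ∩ N Lˣ] = 1`, Chevalley reads `#Cl(L)^G · 2 = h(K) · ∏ e_𝔭`, and `4 ∣ ∏ e_𝔭` makes `#Cl(L)^G` even; but `#Cl(L)^G ∣ h(L) ∣ h⁺(L)` —
contradiction.

* §1 `map_signHom_unitsRange_eq_top_of_odd_narrowClassNumber` — `h⁺` odd ⟹ unit signatures onto; `exists_unit_signs_of_odd_narrowClassNumber`.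
* §2 `realExtension` lemmas: a real embedding `ρ` of `K` extends to a real embedding `ψ` of the totally real `L`; `ψ ∘ σ ≠ ψ` for `σ ≠ 1`;
  `ρ(N_{L/K} x) = ψ(x) · ψ(σ x)` in a quadratic extension.
* §3 `unitsK_le_norm_of_odd_narrowClassNumber` — `h⁺(K)`, `h⁺(L)` odd, `L/K` quadratic totally real ⟹ `E_K ⊆ N_{L/K} Lˣ`;
  `relIndex_unitsNorm_eq_one_of_odd_narrowClassNumber`.
* §4 ★ `even_narrowClassNumber_of_quadratic_of_isTotallyReal_of_odd_narrowClassNumber` — THE THEOREM; and the `2`-rank wording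
  `two_dvd_index_range_pow_two_narrowClassGroup_of_quadratic` (`2 ∣ [Cl⁺(L) : Cl⁺(L)²]`, i.e. `rank₂ Cl⁺(L) ≥ 1`).

References: [Gras2003] IV.4 (genus theory with signatures; narrow ambiguous classes); [Lang1990] Ch. 13 §4 Lemma 4.1 (PDF pp. 203–204); [FrohlichTaylor1990] Ch. V §1 (1.12), p. 164.
-/

noncomputable section

open NumberField NumberField.InfinitePlace IsDedekindDomain
open scoped nonZeroDivisors

namespace Literature.NumberTheory.NumberFields.AmbiguousClass

open Literature.NumberTheory.GaloisRepresentations Literature.NumberTheory.GaloisRepresentations.Herbrand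
  Literature.NumberTheory.GaloisRepresentations.MinkowskiUnit
  Literature.NumberTheory.GaloisRepresentations.CyclicNormIndex

variable {K L : Type} [Field K] [NumberField K] [Field L] [NumberField L] [Algebra K L]

/-! ## §1 `h⁺` odd ⟹ the units take every signature -/

omit [NumberField K] [Algebra K L] in
/-- **`h⁺(L)` odd ⟹ the unit signature map of `L` is ONTO `𝔽₂^{r₁(L)}`**: from `h⁺ · #sign(U) = h · 2^{r₁}` (Fröhlich–Taylor V (1.12), tree
`narrowClassNumber_mul_card_unitSignatures`) the odd `h⁺` forces `2^{r₁} ∣ #sign(U)`, and `sign(U)` sits in a group of order `2^{r₁}`.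
[cite: FrohlichTaylor1990, Ch. V §1 (1.12)–(1.13), p. 164] -/
theorem map_signHom_unitsRange_eq_top_of_odd_narrowClassNumber (hodd : Odd (narrowClassNumber L)) :
    (unitsRange L).map (Literature.NumberTheory.NumberFields.signHom L) = ⊤ := by
  classical
  set S := (unitsRange L).map (Literature.NumberTheory.NumberFields.signHom L) with hS
  have hprod := narrowClassNumber_mul_card_unitSignatures L
  have htop : Nat.card (⊤ : Subgroup (Multiplicative ((L →+* ℝ) → ZMod 2))) = 2 ^ Fintype.card (L →+* ℝ) := by
    rw [Subgroup.card_top]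
    change Nat.card ((L →+* ℝ) → ZMod 2) = _
    rw [Nat.card_fun, Nat.card_zmod, Nat.card_eq_fintype_card]
  -- `2^{r₁} ∣ h⁺ · #S` and `h⁺` odd ⟹ `2^{r₁} ∣ #S`
  have hdvd : 2 ^ Fintype.card (L →+* ℝ) ∣ Nat.card S := by
    have h1 : 2 ^ Fintype.card (L →+* ℝ) ∣ narrowClassNumber L * Nat.card S := by
      rw [← hS] at hprod
      exact Dvd.intro_left _ hprod.symm
    have hcop : Nat.Coprime (2 ^ Fintype.card (L →+* ℝ)) (narrowClassNumber L) :=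
      Nat.Coprime.pow_left _ (Nat.coprime_two_left.mpr hodd)
    exact hcop.dvd_of_dvd_mul_left h1
  have hle : Nat.card S ≤ Nat.card (⊤ : Subgroup (Multiplicative ((L →+* ℝ) → ZMod 2))) :=
    Subgroup.card_le_of_le le_top
  rw [htop] at hle
  have hcard : Nat.card S = Nat.card (⊤ : Subgroup (Multiplicative ((L →+* ℝ) → ZMod 2))) := by
    rw [htop]; exact le_antisymm hle (Nat.le_of_dvd (Nat.card_pos) hdvd)
  exact Subgroup.eq_top_of_card_eq S (by rw [hcard, Subgroup.card_top])

omit [NumberField K] [Algebra K L] in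
/-- **`h⁺(L)` odd ⟹ units of prescribed signs**: for every `t : (L →+* ℝ) → ZMod 2` there is a unit `w` of `𝓞 L` with `χ(w) < 0 ⟺ t χ = 1`
for every real embedding `χ`. [cite: FrohlichTaylor1990, Ch. V §1 (1.12)–(1.13), p. 164] -/
theorem exists_unit_signs_of_odd_narrowClassNumber (hodd : Odd (narrowClassNumber L)) (t : (L →+* ℝ) → ZMod 2) :
    ∃ w : (𝓞 L)ˣ, ∀ χ : L →+* ℝ, χ ((w : 𝓞 L) : L) < 0 ↔ t χ = 1 := by
  classical
  have htop := map_signHom_unitsRange_eq_top_of_odd_narrowClassNumber (L := L) hodd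
  have hmem : Multiplicative.ofAdd t ∈ (unitsRange L).map (Literature.NumberTheory.NumberFields.signHom L) := by
    rw [htop]; exact Subgroup.mem_top _
  obtain ⟨x, hx, hxt⟩ := hmem
  obtain ⟨w, rfl⟩ := (mem_unitsRange_iff L).mp hx
  refine ⟨w, fun χ => ?_⟩
  have h := Literature.NumberTheory.NumberFields.signHom_apply L (Units.map (algebraMap (𝓞 L) L : 𝓞 L →* L) w) χ
  rw [hxt, toAdd_ofAdd, Units.coe_map, MonoidHom.coe_coe] at h
  change t χ = if χ ((w : 𝓞 L) : L) < 0 then 1 else 0 at h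
  constructor
  · intro hlt; rw [h, if_pos hlt]
  · intro ht
    by_contra hge
    rw [h, if_neg hge] at ht
    exact zero_ne_one ht

/-! ## §2 Real embeddings of the totally real `L` above a real embedding of `K`; the sign of a norm -/

/-- **A real embedding `ρ` of `K` extends to a real embedding of the totally real `L`** (lift `ρ` to `L → ℂ`; the lift is real).
[cite: Lang1990, Ch. 13 §4 (archimedean places in `L/K`) (PDF p. 203)] -/
theorem exists_realEmbedding_comp_eq [IsTotallyReal L] (ρ : K →+* ℝ) :
    ∃ ψ : L →+* ℝ, ψ.comp (algebraMap K L) = ρ := by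
  set φ : L →+* ℂ := ComplexEmbedding.lift L (Complex.ofRealHom.comp ρ) with hφ
  have hreal : ComplexEmbedding.IsReal φ := IsTotallyReal.complexEmbedding_isReal φ
  refine ⟨hreal.embedding, RingHom.ext fun x => Complex.ofReal_injective ?_⟩
  rw [RingHom.comp_apply, ComplexEmbedding.IsReal.coe_embedding_apply hreal, hφ,
    ComplexEmbedding.lift_algebraMap_apply]
  rfl

omit [NumberField K] [NumberField L] in
/-- `ψ ∘ σ ≠ ψ` for a real embedding `ψ` of `L` and a non-trivial `K`-automorphism `σ` (`ψ` is injective). [folklore] -/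
private theorem realEmbedding_comp_algEquiv_ne {σ : L ≃ₐ[K] L} (hσ : σ ≠ 1) (ψ : L →+* ℝ) :
    ψ.comp (σ : L →+* L) ≠ ψ := by
  intro h
  apply hσ
  ext x
  exact ψ.injective (by simpa using RingHom.congr_fun h x)

/-- **`ρ(N_{L/K} x) = ψ(x) · ψ(σ x)`** for `L/K` Galois of degree `2` with `Gal = {1, σ}`, `ψ` a real embedding of `L` above the real embedding `ρ`
of `K`. [cite: Lang1990, Ch. 13 §4 (PDF p. 203)] -/
theorem realEmbedding_norm_eq_mul [IsGalois K L] {σ : L ≃ₐ[K] L} (hσ1 : σ ≠ 1) (hall : ∀ f : L ≃ₐ[K] L, f = 1 ∨ f = σ)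
    {ρ : K →+* ℝ} {ψ : L →+* ℝ} (hψ : ψ.comp (algebraMap K L) = ρ) (x : L) :
    ρ (Algebra.norm K x) = ψ x * ψ (σ x) := by
  classical
  have h1 : ρ (Algebra.norm K x) = ψ (algebraMap K L (Algebra.norm K x)) := by
    rw [← hψ]; rfl
  rw [h1, Algebra.norm_eq_prod_automorphisms]
  have huniv : (Finset.univ : Finset (L ≃ₐ[K] L)) = {1, σ} := by
    ext f
    simp only [Finset.mem_univ, Finset.mem_insert, Finset.mem_singleton, true_iff]
    exact hall f
  rw [huniv, Finset.prod_pair hσ1.symm, map_mul, AlgEquiv.one_apply]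

/-! ## §3 `h⁺(K)` and `h⁺(L)` odd ⟹ every unit of `K` is a norm from `Lˣ` -/

/-- **Every unit of `K` is a norm from `Lˣ`** when `L/K` is quadratic, `L` (hence `K`) totally real and `h⁺(K)`, `h⁺(L)` are odd: a unit `w` of
`L` with the right signs makes `u / N(w)` totally positive, hence a square `ε²` (`h⁺(K)` odd), and `u = N(ε) · N(w)`.  In the currency of
Chevalley's formula: `E_K = 𝓞_Lˣ ∩ Kˣ ≤ 𝓞_Lˣ ∩ N_G(Lˣ)`. [cite: Gras2003, IV.4] [cite: FrohlichTaylor1990, Ch. V §1 (1.12), p. 164]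
[cite: Lang1990, Ch. 13 §4, Lemma 4.1 and proof of Lemma 4.2 (PDF pp. 203–204)] -/
theorem unitsK_le_norm_of_odd_narrowClassNumber [IsGalois K L] [IsTotallyReal K] [IsTotallyReal L] (h2 : Module.finrank K L = 2)
    (hK : Odd (narrowClassNumber K)) (hL : Odd (narrowClassNumber L)) :
    unitsE L ⊓ (unitsIncl K L).range ≤ unitsE L ⊓ (⊤ : Subgroup Lˣ).map (Herbrand.norm (L ≃ₐ[K] L)) := by
  classical
  obtain ⟨σ, hσ1, hall, hσ⟩ := exists_algEquiv_ne_one_of_finrank_eq_two (K := K) (L := L) h2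
  -- a real embedding of `L` above each real embedding of `K`
  choose ψ hψ using fun ρ : K →+* ℝ => exists_realEmbedding_comp_eq (K := K) (L := L) ρ
  have h1 := card_totPosUnitsModSq_eq_one_of_odd_narrowClassNumber K hK
  rw [← range_unitsIncl_comp_unitsMap_eq]
  rintro _ ⟨u, rfl⟩
  set Φ : (𝓞 K)ˣ →* Lˣ := (unitsIncl K L).comp (Units.map (algebraMap (𝓞 K) K : 𝓞 K →* K)) with hΦ
  have hΦE : ∀ v : (𝓞 K)ˣ, Φ v ∈ unitsE L ⊓ (unitsIncl K L).range := fun v => by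
    rw [← range_unitsIncl_comp_unitsMap_eq]; exact ⟨v, rfl⟩
  -- the sign prescription: at `ψ ρ` the sign of `ρ(u)`, at `ψ ρ ∘ σ` the sign `+`
  let t : (L →+* ℝ) → ZMod 2 := fun χ =>
    if χ = ψ (χ.comp (algebraMap K L)) then (if (χ.comp (algebraMap K L)) ((u : 𝓞 K) : K) < 0 then 1 else 0) else 0
  obtain ⟨w, hw⟩ := exists_unit_signs_of_odd_narrowClassNumber (L := L) hL t
  -- the norm of `w` as a unit of `𝓞 K`
  have hnU : IsUnit (RingOfIntegers.norm K (w : 𝓞 L)) := (RingOfIntegers.isUnit_norm_of_isGalois K).mpr w.isUnit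
  set n : (𝓞 K)ˣ := hnU.unit with hn
  have hnval : ((n : 𝓞 K) : K) = Algebra.norm K ((w : 𝓞 L) : L) := by
    rw [hn, IsUnit.unit_spec, RingOfIntegers.coe_norm]
  -- `u · n` is totally positive
  have hpos : ∀ ρ : K →+* ℝ, 0 < ρ (((u * n : (𝓞 K)ˣ) : 𝓞 K) : K) := by
    intro ρ
    have hρn : ρ (((n : 𝓞 K)) : K) = ψ ρ ((w : 𝓞 L) : L) * ψ ρ (σ ((w : 𝓞 L) : L)) := by
      rw [hnval]; exact realEmbedding_norm_eq_mul hσ1 hall (hψ ρ) _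
    -- signs of the two factors
    have hw0 : ∀ χ : L →+* ℝ, χ ((w : 𝓞 L) : L) ≠ 0 := fun χ =>
      (map_ne_zero χ).mpr (by exact_mod_cast w.ne_zero)
    have hcompρ : (ψ ρ).comp (algebraMap K L) = ρ := hψ ρ
    have hcompσ : ((ψ ρ).comp (σ : L →+* L)).comp (algebraMap K L) = ρ := by
      rw [RingHom.comp_assoc]
      have : (σ : L →+* L).comp (algebraMap K L) = algebraMap K L := by
        ext x; exact σ.commutes x
      rw [this, hcompρ]
    have ht1 : t (ψ ρ) = if ρ ((u : 𝓞 K) : K) < 0 then 1 else 0 := by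
      simp only [t, hcompρ, if_true]
    have ht2 : t ((ψ ρ).comp (σ : L →+* L)) = 0 := by
      simp only [t, hcompσ]
      rw [if_neg (realEmbedding_comp_algEquiv_ne hσ1 (ψ ρ))]
    have hs2 : 0 < ψ ρ (σ ((w : 𝓞 L) : L)) := by
      have hnot : ¬ ((ψ ρ).comp (σ : L →+* L)) ((w : 𝓞 L) : L) < 0 := by
        rw [hw, ht2]; exact zero_ne_one
      have hne : ((ψ ρ).comp (σ : L →+* L)) ((w : 𝓞 L) : L) ≠ 0 := hw0 _
      have := lt_of_le_of_ne (not_lt.mp hnot) hne.symm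
      simpa using this
    have hu0 : ρ ((u : 𝓞 K) : K) ≠ 0 := (map_ne_zero ρ).mpr (by exact_mod_cast u.ne_zero)
    have hval : ρ (((u * n : (𝓞 K)ˣ) : 𝓞 K) : K) = ρ ((u : 𝓞 K) : K) * ρ ((n : 𝓞 K) : K) := by
      rw [← map_mul, Units.val_mul]; rfl
    rw [hval, hρn]
    by_cases hneg : ρ ((u : 𝓞 K) : K) < 0
    · have hs1 : ψ ρ ((w : 𝓞 L) : L) < 0 := by rw [hw, ht1, if_pos hneg]
      exact mul_pos_of_neg_of_neg hneg (mul_neg_of_neg_of_pos hs1 hs2)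
    · have hs1 : 0 < ψ ρ ((w : 𝓞 L) : L) := by
        have hnot : ¬ ψ ρ ((w : 𝓞 L) : L) < 0 := by rw [hw, ht1, if_neg hneg]; exact zero_ne_one
        exact lt_of_le_of_ne (not_lt.mp hnot) (hw0 _).symm
      exact mul_pos (lt_of_le_of_ne (not_lt.mp hneg) hu0.symm) (mul_pos hs1 hs2)
  -- hence a square
  obtain ⟨ε, hε⟩ := exists_units_eq_sq_of_card_totPosUnitsModSq_eq_one h1 (u * n) hpos
  have hu : u = ε ^ 2 * n⁻¹ := by rw [← hε, mul_inv_cancel_right]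
  -- `Φ n = N(w)` and `Φ ε ^ 2` are norms
  set wL : Lˣ := Units.map (algebraMap (𝓞 L) L : 𝓞 L →* L) w with hwL
  have hΦn : Φ n = Herbrand.norm (L ≃ₐ[K] L) wL := by
    apply Units.ext
    rw [coe_herbrandNorm_eq_algebraMap_norm hσ wL, hΦ, MonoidHom.comp_apply, coe_unitsIncl, Units.coe_map,
      MonoidHom.coe_coe]
    change algebraMap K L ((n : 𝓞 K) : K) = algebraMap K L (Algebra.norm K ((wL : Lˣ) : L))
    rw [hnval]
    rfl
  refine ⟨(hΦE u).1, ?_⟩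
  rw [hu, map_mul, map_pow, map_inv]
  refine Subgroup.mul_mem _ ?_ (Subgroup.inv_mem _ ⟨wL, Subgroup.mem_top _, hΦn.symm⟩)
  have h := pow_finrank_mem_map_norm (K := K) (L := L) (hΦE ε).2
  rwa [h2] at h

/-- **The unit index of Chevalley's formula is `1`** under the hypotheses of `unitsK_le_norm_of_odd_narrowClassNumber`.
[cite: Lang1990, Ch. 13 §4, Lemma 4.1 (PDF p. 203)] [cite: Gras2003, IV.4] -/
theorem relIndex_unitsNorm_eq_one_of_odd_narrowClassNumber [IsGalois K L] [IsTotallyReal K] [IsTotallyReal L]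
    (h2 : Module.finrank K L = 2) (hK : Odd (narrowClassNumber K)) (hL : Odd (narrowClassNumber L)) :
    (unitsE L ⊓ (⊤ : Subgroup Lˣ).map (Herbrand.norm (L ≃ₐ[K] L))).relIndex (unitsE L ⊓ (unitsIncl K L).range) = 1 :=
  Subgroup.relIndex_eq_one.mpr (unitsK_le_norm_of_odd_narrowClassNumber h2 hK hL)

/-! ## §4 The parity ascent -/

/-- ★ **Narrow class number parity goes up a totally real quadratic extension with at least two ramified finite primes.**  `L/K` Galois of
degree `2`, `L` totally real (so `K` is), `4 ∣ ∏_𝔭 e_𝔭(L/K)` (at least two finite primes of `K` ramify, each with `e = 2`), `h⁺(K)` odd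
⟹ `h⁺(L)` even.  (Narrow genus theory: `#Am⁺(L/K) = h⁺(K) · 2^{t−1}` is even; here via the ordinary Chevalley formula, §3 and
`#Cl(L)^G ∣ h(L) ∣ h⁺(L)`.) [cite: Gras2003, IV.4 (genus theory with signatures)]
[cite: Lang1990, Ch. 13 §4, Lemma 4.1 (PDF pp. 203–204)] [cite: FrohlichTaylor1990, Ch. V §1 (1.12), p. 164] -/
theorem even_narrowClassNumber_of_quadratic_of_isTotallyReal_of_odd_narrowClassNumber [IsGalois K L] [IsTotallyReal L]
    (h2 : Module.finrank K L = 2) (hram : 4 ∣ ∏ᶠ v : HeightOneSpectrum (𝓞 K), v.asIdeal.ramificationIdxIn (𝓞 L))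
    (hK : Odd (narrowClassNumber K)) : Even (narrowClassNumber L) := by
  classical
  haveI : Algebra.IsAlgebraic K L := Algebra.IsAlgebraic.of_finite K L
  haveI : IsTotallyReal K := IsTotallyReal.of_algebra K L
  by_contra hodd
  rw [Nat.not_even_iff_odd] at hodd
  obtain ⟨σ, -, -, hσ⟩ := exists_algEquiv_ne_one_of_finrank_eq_two (K := K) (L := L) h2
  have hChev := ambiguousClassNumberFormula hσ
  rw [h2, archFactor_eq_one_of_isTotallyReal, mul_one, relIndex_unitsNorm_eq_one_of_odd_narrowClassNumber h2 hK hodd,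
    mul_one] at hChev
  obtain ⟨k, hk⟩ := hram
  rw [hk] at hChev
  -- `#Cl(L)^G · 2 = h_K · 4k` ⟹ `#Cl(L)^G = 2 · (h_K k)` is even
  have hfix : Nat.card {c : ClassGroup (𝓞 L) // ∀ τ : L ≃ₐ[K] L, ClassGroup.mulEquiv (intAut τ) c = c} =
      2 * (classNumber K * k) := by
    have h4 : Nat.card {c : ClassGroup (𝓞 L) // ∀ τ : L ≃ₐ[K] L, ClassGroup.mulEquiv (intAut τ) c = c} * 2 =
        2 * (classNumber K * k) * 2 := by rw [hChev]; ring
    exact Nat.eq_of_mul_eq_mul_right (by norm_num) h4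
  have h2fix : 2 ∣ Nat.card {c : ClassGroup (𝓞 L) // ∀ τ : L ≃ₐ[K] L, ClassGroup.mulEquiv (intAut τ) c = c} :=
    ⟨_, hfix⟩
  have h2hL : 2 ∣ narrowClassNumber L :=
    (h2fix.trans (card_fixed_dvd_classNumber (K := K) (L := L))).trans (classNumber_dvd_narrowClassNumber L)
  exact (Nat.not_even_iff_odd.mpr hodd) (even_iff_two_dvd.mpr h2hL)

/-- **The `2`-rank wording: `2 ∣ [Cl⁺(L) : Cl⁺(L)²]`**, i.e. `rank₂ Cl⁺(L) ≥ 1`, under the same hypotheses (a finite abelian group of even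
order has a non-trivial quotient by its squares). [cite: Gras2003, IV.4] [cite: Washington1997, §13.3 (p-ranks)] -/
theorem two_dvd_index_range_pow_two_narrowClassGroup_of_quadratic [IsGalois K L] [IsTotallyReal L]
    (h2 : Module.finrank K L = 2) (hram : 4 ∣ ∏ᶠ v : HeightOneSpectrum (𝓞 K), v.asIdeal.ramificationIdxIn (𝓞 L))
    (hK : Odd (narrowClassNumber K)) :
    2 ∣ (powMonoidHom (α := NarrowClassGroup L) 2).range.index := by
  classical
  have heven := even_narrowClassNumber_of_quadratic_of_isTotallyReal_of_odd_narrowClassNumber h2 hram hK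
  have hne : narrowClassNumber L ≠ 0 := by
    intro h0
    have h := narrowClassNumber_mul_card_unitSignatures L
    rw [h0, zero_mul] at h
    exact mul_ne_zero (Fintype.card_ne_zero (α := ClassGroup (𝓞 L))) (pow_ne_zero _ two_ne_zero) h.symm
  haveI : Finite (NarrowClassGroup L) := Nat.finite_of_card_ne_zero hne
  set f := powMonoidHom (α := NarrowClassGroup L) 2 with hf
  -- Cauchy: an element of order `2`; it lies in `ker f`
  have hdvd : 2 ∣ Nat.card (NarrowClassGroup L) := even_iff_two_dvd.mp heven
  obtain ⟨g, hg⟩ := exists_prime_orderOf_dvd_card' 2 hdvd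
  have hgker : g ∈ f.ker := by
    rw [MonoidHom.mem_ker, hf, powMonoidHom_apply, ← hg, pow_orderOf_eq_one]
  -- `[G : range f] = #ker f` (first isomorphism theorem, counted)
  have hidx : f.range.index = Nat.card f.ker := by
    have h1 := f.ker.index_mul_card
    have h2' := f.range.index_mul_card
    rw [Subgroup.index_ker] at h1
    have hpos : 0 < Nat.card f.range := Nat.card_pos
    apply Nat.eq_of_mul_eq_mul_left hpos
    calc Nat.card f.range * f.range.index = f.range.index * Nat.card f.range := mul_comm _ _
      _ = Nat.card (NarrowClassGroup L) := h2'
      _ = Nat.card f.range * Nat.card f.ker := h1.symm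
  rw [hidx]
  have h := orderOf_dvd_natCard (⟨g, hgker⟩ : f.ker)
  rwa [Subgroup.orderOf_mk, hg] at h

end Literature.NumberTheory.NumberFields.AmbiguousClass

end
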